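import Mathlib
import HarnessLib
import Summits.ValiantsHypothesis.ValiantsHypothesis.Theorems.MonotoneRestorationOrbitRestorationLinearVolumeQPHomPolyVNPWitness
import Summits.ValiantsHypothesis.ValiantsHypothesis.Theorems.MonotoneRestorationOrbitRestorationLinearVolumeQPHomPolyBasics

/-!
# Homomorphism polynomials of polynomial-size patterns are p-definable (`VNP`) — bounds and the family

Second half of `…LinearVolumeQPHomPolyVNPWitness.lean` (route MonotoneRestoration, aside R1 =
`OrbitRestorationLinearVolumeQP`, stmt-ValiantsHypothesis-18294): polynomial degree and complexity bounds for the
witness `homWitness` (`≤ 9 M⁴`, `≤ 30 M⁴` with `a, b, n, |E| ≤ M`), and the family-level statement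

* `isVNPFamily_homPoly` — for bipartite multigraph patterns `F_n = (Fin (a n) ⊔ Fin (b n), E n)` with
  `a n, b n, |E n| ≤ (n+2)^c`, the family `(hom_{F_n,n})_n` (tree `homPoly`) is a `VNP` family over every
  commutative ring (Bürgisser 2000 Def. 2.5 literally; Boolean sum of length `a n · n + b n · n`).

It discharges hypothesis `hVNP` of
`OrbitRestorationLinearVolumeQPVHStrength.valiantsHypothesis_of_orbitRestorationLinearVolumeQP_of_separatingPattern`.
Honest framing: a standard Valiant-criterion instance; nothing here bears on R1, the crux or VP ≠ VNP.
-/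

noncomputable section

open MvPolynomial Equiv

-- `Summit.ValiantsHypothesis.ValiantsHypothesis.…` is the tree's single-conjunct layout (Sub = Summit).
set_option linter.dupNamespace false

namespace Summit.ValiantsHypothesis.ValiantsHypothesis.Theorems

namespace HomPolyVNP

open Literature.Computability.AlgebraicComplexity

universe u

/-! ### Degree and complexity of the witness -/

section Bounds

variable {σ : Type*} {R : Type*} [CommSemiring R]

/-- Degree of a multiset product with uniformly bounded factors. [folklore] -/
theorem totalDegree_multiset_map_prod_le {ι : Type*} (s : Multiset ι) (f : ι → MvPolynomial σ R) (d : ℕ)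
    (h : ∀ i ∈ s, (f i).totalDegree ≤ d) :
    ((s.map f).prod).totalDegree ≤ Multiset.card s * d := by
  induction s using Multiset.induction_on with
  | empty => simp
  | cons x s ih =>
    rw [Multiset.map_cons, Multiset.prod_cons, Multiset.card_cons]
    have hx := h x (Multiset.mem_cons_self x s)
    have hs := ih fun i hi => h i (Multiset.mem_cons_of_mem hi)
    calc (f x * (s.map f).prod).totalDegree ≤ (f x).totalDegree + ((s.map f).prod).totalDegree :=
          totalDegree_mul _ _
      _ ≤ d + Multiset.card s * d := add_le_add hx hs
      _ = (Multiset.card s + 1) * d := by ring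

/-- Complexity of a multiset product with uniformly bounded factors: `L(Π_{i ∈ s} f i) ≤ |s| (d + 1)`.
[cite: BurgisserClausenShokrollahi1997, (21.4)] -/
theorem complexity_multiset_map_prod_le {ι : Type*} (s : Multiset ι) (f : ι → MvPolynomial σ R) (d : ℕ)
    (h : ∀ i ∈ s, complexity (f i) ≤ d) :
    complexity ((s.map f).prod) ≤ Multiset.card s * (d + 1) := by
  induction s using Multiset.induction_on with
  | empty =>
    rw [Multiset.map_zero, Multiset.prod_zero, ← C_1, complexity_C_holds]
    exact Nat.zero_le _
  | cons x s ih =>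
    rw [Multiset.map_cons, Multiset.prod_cons, Multiset.card_cons]
    have hx := h x (Multiset.mem_cons_self x s)
    have hs := ih fun i hi => h i (Multiset.mem_cons_of_mem hi)
    have hm := complexity_mul_le_holds (f x) ((s.map f).prod)
    calc complexity (f x * (s.map f).prod) ≤ complexity (f x) + complexity ((s.map f).prod) + 1 := hm
      _ ≤ d + Multiset.card s * (d + 1) + 1 := by omega
      _ = (Multiset.card s + 1) * (d + 1) := by ring

variable (a b n : ℕ) (k : Type u) [CommRing k]

/-- `deg R_a ≤ 2 (a n)² + a`. [cite: BurgisserClausenShokrollahi1997, Prop. (21.15)] -/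
theorem totalDegree_recA_le : (recA a b n k).totalDegree ≤ (a * n) * (a * n) * 2 + a * 1 := by
  unfold recA
  refine (totalDegree_mul _ _).trans (add_le_add ?_ ?_)
  · exact (totalDegree_prod_le_of_le _ _ _ fun pq _ => totalDegree_one_sub_X_mul_X_le _ _).trans
      (Nat.mul_le_mul_right 2 (card_fnConflicts_le _ _))
  · refine (totalDegree_prod_le_of_le _ _ _ fun t _ =>
      totalDegree_sum_le_of_le _ _ _ fun i _ => totalDegree_X_le_one _).trans ?_
    simp

/-- `deg R_b ≤ 2 (b n)² + b`. [cite: BurgisserClausenShokrollahi1997, Prop. (21.15)] -/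
theorem totalDegree_recB_le : (recB a b n k).totalDegree ≤ (b * n) * (b * n) * 2 + b * 1 := by
  unfold recB
  refine (totalDegree_mul _ _).trans (add_le_add ?_ ?_)
  · exact (totalDegree_prod_le_of_le _ _ _ fun pq _ => totalDegree_one_sub_X_mul_X_le _ _).trans
      (Nat.mul_le_mul_right 2 (card_fnConflicts_le _ _))
  · refine (totalDegree_prod_le_of_le _ _ _ fun t _ =>
      totalDegree_sum_le_of_le _ _ _ fun i _ => totalDegree_X_le_one _).trans ?_
    simp

/-- `L(R_a) ≤ 4 (a n)² + a (n + 1) + 1`. [cite: BurgisserClausenShokrollahi1997, Prop. (21.15)] -/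
theorem complexity_recA_le :
    complexity (recA a b n k) ≤ ((a * n) * (a * n) * 3 + (a * n) * (a * n)) + (a * (n * 0 + n) + a) + 1 := by
  unfold recA
  refine (complexity_mul_le_holds _ _).trans (add_le_add (add_le_add ?_ ?_) le_rfl)
  · refine (complexity_prod_le_of_le _ _ _ fun pq _ => complexity_one_sub_X_mul_X_le _ _).trans ?_
    have h := card_fnConflicts_le a n
    gcongr
  · refine (complexity_prod_le_of_le _ _ _ fun t _ => complexity_sum_le_of_le _ _ _ fun i _ =>
      le_of_eq (complexity_X_holds (k := k) _)).trans ?_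
    simp

/-- `L(R_b) ≤ 4 (b n)² + b (n + 1) + 1`. [cite: BurgisserClausenShokrollahi1997, Prop. (21.15)] -/
theorem complexity_recB_le :
    complexity (recB a b n k) ≤ ((b * n) * (b * n) * 3 + (b * n) * (b * n)) + (b * (n * 0 + n) + b) + 1 := by
  unfold recB
  refine (complexity_mul_le_holds _ _).trans (add_le_add (add_le_add ?_ ?_) le_rfl)
  · refine (complexity_prod_le_of_le _ _ _ fun pq _ => complexity_one_sub_X_mul_X_le _ _).trans ?_
    have h := card_fnConflicts_le b n
    gcongr
  · refine (complexity_prod_le_of_le _ _ _ fun t _ => complexity_sum_le_of_le _ _ _ fun i _ =>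
      le_of_eq (complexity_X_holds (k := k) _)).trans ?_
    simp

variable {a b}

/-- `deg (edge product) ≤ 3 |E|`. [folklore] -/
theorem totalDegree_edgeProd_le (E : Multiset (Fin a × Fin b)) :
    (edgeProd n k E).totalDegree ≤ Multiset.card E * 3 := by
  unfold edgeProd
  exact totalDegree_multiset_map_prod_le _ _ _ fun e _ =>
    totalDegree_sum_le_of_le _ _ _ fun v _ => totalDegree_sum_le_of_le _ _ _ fun w _ =>
      totalDegree_X_mul_X_mul_X_le _ _ _

/-- `L(edge product) ≤ |E| (3 n² + n + 1)`. [folklore] -/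
theorem complexity_edgeProd_le (E : Multiset (Fin a × Fin b)) :
    complexity (edgeProd n k E) ≤ Multiset.card E * ((n * (n * 2 + n) + n) + 1) := by
  unfold edgeProd
  refine complexity_multiset_map_prod_le _ _ _ fun e _ => ?_
  refine (complexity_sum_le_of_le _ _ _ fun v _ => complexity_sum_le_of_le _ _ _ fun w _ =>
    complexity_X_mul_X_mul_X_le _ _ _).trans ?_
  simp

/-- **Polynomial degree bound for the witness**: with `a, b, n, |E| ≤ M` (`M ≥ 1`),
`deg (homWitness) ≤ 9 M⁴`. [folklore] -/
theorem totalDegree_homWitness_le (E : Multiset (Fin a × Fin b)) (M : ℕ) (hM : 1 ≤ M) (ha : a ≤ M)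
    (hb : b ≤ M) (hn : n ≤ M) (hE : Multiset.card E ≤ M) :
    (homWitness n k E).totalDegree ≤ 9 * M ^ 4 := by
  have h1 := totalDegree_recA_le a b n k
  have h2 := totalDegree_recB_le a b n k
  have h3 := totalDegree_edgeProd_le n k E
  have han : a * n ≤ M * M := Nat.mul_le_mul ha hn
  have hbn : b * n ≤ M * M := Nat.mul_le_mul hb hn
  have hP : (a * n) * (a * n) ≤ M ^ 4 := by
    calc (a * n) * (a * n) ≤ (M * M) * (M * M) := Nat.mul_le_mul han han
      _ = M ^ 4 := by ring
  have hQ : (b * n) * (b * n) ≤ M ^ 4 := by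
    calc (b * n) * (b * n) ≤ (M * M) * (M * M) := Nat.mul_le_mul hbn hbn
      _ = M ^ 4 := by ring
  have hM4 : M ≤ M ^ 4 := by
    calc M = M ^ 1 := (pow_one M).symm
      _ ≤ M ^ 4 := Nat.pow_le_pow_right hM (by norm_num)
  unfold homWitness
  refine (totalDegree_mul _ _).trans ?_
  refine (add_le_add le_rfl (totalDegree_mul _ _)).trans ?_
  omega

/-- **Polynomial complexity bound for the witness**: with `a, b, n, |E| ≤ M` (`M ≥ 1`),
`L(homWitness) ≤ 30 M⁴`. [folklore] -/
theorem complexity_homWitness_le (E : Multiset (Fin a × Fin b)) (M : ℕ) (hM : 1 ≤ M) (ha : a ≤ M)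
    (hb : b ≤ M) (hn : n ≤ M) (hE : Multiset.card E ≤ M) :
    complexity (homWitness n k E) ≤ 30 * M ^ 4 := by
  have h1 := complexity_recA_le a b n k
  have h2 := complexity_recB_le a b n k
  have h3 := complexity_edgeProd_le n k E
  have han : a * n ≤ M * M := Nat.mul_le_mul ha hn
  have hbn : b * n ≤ M * M := Nat.mul_le_mul hb hn
  have hP : (a * n) * (a * n) ≤ M ^ 4 := by
    calc (a * n) * (a * n) ≤ (M * M) * (M * M) := Nat.mul_le_mul han han
      _ = M ^ 4 := by ring
  have hQ : (b * n) * (b * n) ≤ M ^ 4 := by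
    calc (b * n) * (b * n) ≤ (M * M) * (M * M) := Nat.mul_le_mul hbn hbn
      _ = M ^ 4 := by ring
  have hM4 : M ≤ M ^ 4 := by
    calc M = M ^ 1 := (pow_one M).symm
      _ ≤ M ^ 4 := Nat.pow_le_pow_right hM (by norm_num)
  have hMM : M * M ≤ M ^ 4 := by
    calc M * M = M ^ 2 := (sq M).symm
      _ ≤ M ^ 4 := Nat.pow_le_pow_right hM (by norm_num)
  have h14 : 1 ≤ M ^ 4 := Nat.one_le_pow _ _ hM
  -- `a (n*0 + n) + a ≤ 2 M²`, `|E| (3n² + n + 1) ≤ M (3 M² + M + 1) ≤ 5 M⁴`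
  have hA2 : a * (n * 0 + n) + a ≤ M * M + M := by
    rw [Nat.mul_zero, Nat.zero_add]; exact add_le_add han ha
  have hB2 : b * (n * 0 + n) + b ≤ M * M + M := by
    rw [Nat.mul_zero, Nat.zero_add]; exact add_le_add hbn hb
  have hE3 : Multiset.card E * ((n * (n * 2 + n) + n) + 1) ≤ M * ((M * (M * 2 + M) + M) + 1) :=
    Nat.mul_le_mul hE (by gcongr)
  have hE4 : M * ((M * (M * 2 + M) + M) + 1) ≤ 5 * M ^ 4 := by
    have : M * ((M * (M * 2 + M) + M) + 1) = 3 * (M ^ 2 * M) + M * M + M := by ring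
    rw [this]
    have h3' : M ^ 2 * M ≤ M ^ 4 := by
      calc M ^ 2 * M = M ^ 3 := by ring
        _ ≤ M ^ 4 := Nat.pow_le_pow_right hM (by norm_num)
    omega
  unfold homWitness
  refine (complexity_mul_le_holds _ _).trans ?_
  refine (add_le_add (add_le_add le_rfl (complexity_mul_le_holds _ _)) le_rfl).trans ?_
  omega

end Bounds

/-! ### The family: `hom ∈ VNP` -/

section Family

variable (k : Type u) [CommRing k]

/-- p-boundedness from a bound `K · ((n+2)^c)^d`. [folklore] -/
theorem isPBounded_of_le_mul_pow_pow (t : ℕ → ℕ) (K c d : ℕ) (h : ∀ n, t n ≤ K * ((n + 2) ^ c) ^ d) :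
    IsPBounded t := by
  rw [IsPBounded.iff_exists_le_mul_succ_pow]
  refine ⟨K * 2 ^ (c * d), c * d, fun n => (h n).trans ?_⟩
  have h1 : ((n + 2) ^ c) ^ d = (n + 2) ^ (c * d) := (pow_mul _ _ _).symm
  have h2 : (n + 2) ^ (c * d) ≤ (2 * (n + 1)) ^ (c * d) := Nat.pow_le_pow_left (by omega) _
  rw [h1, mul_assoc, ← mul_pow]
  exact Nat.mul_le_mul_left _ h2

/-- **Homomorphism polynomials of polynomial-size bipartite patterns form a `VNP` family** (p-definable;
Bürgisser 2000 Def. 2.5 literally, witness `homWitness`, Boolean sum of length `a n · n + b n · n`): for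
`F_n = (Fin (a n) ⊔ Fin (b n), E n)` with `a n, b n, |E n| ≤ (n+2)^c`, the family `(hom_{F_n,n})_n` is in `VNP`
over every commutative ring. [cite: DwivediPagoSeppelt2026, eq. (1); BurgisserClausenShokrollahi1997, Prop. (21.15)] -/
theorem isVNPFamily_homPoly (a b : ℕ → ℕ) (E : (n : ℕ) → Multiset (Fin (a n) × Fin (b n))) (c : ℕ)
    (ha : ∀ n, a n ≤ (n + 2) ^ c) (hb : ∀ n, b n ≤ (n + 2) ^ c)
    (hE : ∀ n, Multiset.card (E n) ≤ (n + 2) ^ c) :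
    IsVNPFamily fun n => homPoly (E n) n k := by
  -- the common bound `M n = (n+2)^(c+1)`
  have hM : ∀ n, 1 ≤ (n + 2) ^ (c + 1) := fun n => Nat.one_le_pow _ _ (by omega)
  have hcM : ∀ n, (n + 2) ^ c ≤ (n + 2) ^ (c + 1) := fun n => Nat.pow_le_pow_right (by omega) (by omega)
  have hnM : ∀ n, n ≤ (n + 2) ^ (c + 1) := fun n =>
    (Nat.le_add_right n 2).trans (Nat.le_self_pow (by omega) _)
  refine ⟨⟨?_, ?_⟩, fun n => a n * n + b n * n, fun n => homWitness n k (E n), ⟨⟨?_, ?_⟩, ?_⟩, fun n => ?_⟩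
  · -- variables of `hom`: `n²`
    refine isPBounded_of_le_mul_pow_pow _ 1 1 2 fun n => ?_
    rw [Fintype.card_prod, Fintype.card_fin, one_mul, pow_one, sq]
    exact Nat.mul_le_mul (by omega) (by omega)
  · -- degree of `hom`: `≤ |E n|`
    refine isPBounded_of_le_mul_pow_pow _ 1 c 1 fun n => ?_
    rw [one_mul, pow_one]
    exact (HomPolyBasics.totalDegree_homPoly_le (K := k) (E n) n).trans (hE n)
  · -- variables of the witness: `n² + a n · n + b n · n ≤ 3 M²`
    refine isPBounded_of_le_mul_pow_pow _ 3 (c + 1) 2 fun n => ?_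
    simp only [Fintype.card_sum, Fintype.card_prod, Fintype.card_fin]
    have h1 : n * n ≤ (n + 2) ^ (c + 1) * (n + 2) ^ (c + 1) := Nat.mul_le_mul (hnM n) (hnM n)
    have h2 : a n * n ≤ (n + 2) ^ (c + 1) * (n + 2) ^ (c + 1) :=
      Nat.mul_le_mul ((ha n).trans (hcM n)) (hnM n)
    have h3 : b n * n ≤ (n + 2) ^ (c + 1) * (n + 2) ^ (c + 1) :=
      Nat.mul_le_mul ((hb n).trans (hcM n)) (hnM n)
    nlinarith
  · -- degree of the witness
    refine isPBounded_of_le_mul_pow_pow _ 9 (c + 1) 4 fun n => ?_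
    exact totalDegree_homWitness_le n k (E n) _ (hM n) ((ha n).trans (hcM n)) ((hb n).trans (hcM n))
      (hnM n) ((hE n).trans (hcM n))
  · -- complexity of the witness
    refine isPBounded_of_le_mul_pow_pow _ 30 (c + 1) 4 fun n => ?_
    exact complexity_homWitness_le n k (E n) _ (hM n) ((ha n).trans (hcM n)) ((hb n).trans (hcM n))
      (hnM n) ((hE n).trans (hcM n))
  · -- the Boolean sum
    exact (boolSum_homWitness n k (E n)).symm

end Family

end HomPolyVNP

end Summit.ValiantsHypothesis.ValiantsHypothesis.Theorems

end
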